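import Literature.Probability.RandomPlanarGeometry.HexSAWSurfaceWallRenewalIteratedGap
import HarnessLib

/-!
# The landing law: in the equality case of the sharp count, the left steps land exactly under the interior visits

For the self-avoiding walk on the honeycomb lattice (brick-wall frame) in the half-plane `Y ≤ 0`, an IRREDUCIBLE POSITIVE
WALL BRIDGE `ω ∈ ipwb n` (`n ≥ 4`) with `v = visits n ω` surface visits, `#down` down steps and `E` = the set of interior
visit times that are NEAR-RENEWALS (`NearRenewal` of `…SixStep`) satisfies the SHARP DOWN-STEP COUNT
`X_n + 2·#down + 4v ≤ n + 4 + 2·#E` (`apply_add_two_mul_card_stepsD_add_four_mul_visits_le` of `…SecondGap`).  Its proof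
injects the interior visit times `t < n` into the LEFT steps landing on an even column (`t ↦` the left step landing on the
column `X_t`, `exists_left_step_onto`) and the interior visit times that are not near-renewals into the left steps landing
on an odd column (`t ↦` the left step landing on `X_t − 1`, `exists_left_step_onto_pred`).  This module records what the
EQUALITY CASE `X_n + 2·#down + 4v = n + 4 + 2·#E` of that count says: both injections are then BIJECTIONS, so

* `landing_law` — (even landings) every left step landing on an even column lands on the column of an interior visit;
  (odd landings) every left step landing on an odd column `c` has the interior visit column `c + 1`, at a visit time that
  is NOT a near-renewal; (distinct landings) two left steps never land on the same column.
* `landing_law_four_down` — the equality case holds for an irreducible positive wall bridge at SLACK FOUR (`n = 6k + 4`,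
  `v = k ≥ 2`) with FOUR down steps (`slack_four_counts` of `…IteratedGap`: `X = 2k + 2, #E = 1` or `X = 2k + 4, #E = 2`),
  so the three clauses hold there; and `two_mem_nearRenewal_four_down` — in that class the time `2` is an interior
  near-renewal visit time (`#E = #E₄ + 1`), in particular `ω 2 = (2, 0)`: the first dive happens at a column `≥ 3`.

These are the tools of the ORDER EXCLUSION step of the four-down classification at slack four (successor modules): a
left step of the body can only land under a wall visit, never on the located gap `q + 1` after a dive at the wall column
`q` (`wallTimes_apply_ne_of_dive`), which pins the body of the walk to the right of its first dive.

PROOF.  §1 is the bookkeeping of `…SecondGap` §1 with the two maps kept (`Classical.choose`), the count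
`n = 2·#left + X_n + 2·#down` (`steps_count`, `#up = #down`), `v = #W' + 1` and `#left = #Lev + #Lod`
(`Finset.card_filter_add_card_filter_not`): the hypothesis gives `#left + #E ≤ 2·#W'`, against `#W' ≤ #Lev` and
`#W' − #E ≤ #Lod` (`Finset.card_le_card_of_injOn`), so `#Lev = #W'`, `#Lod = #(W' \ E)` and the maps are onto
(`Finset.surjOn_of_injOn_of_card_le`); distinct visit times have distinct columns (injectivity of the walk on the wall).
§2 is linear arithmetic over `slack_four_counts` and the parity of visit times.

STATUS: lane theorem of the a-idea-1 bridge/renewal lineage (car 94-A «landing law»), the first module of the ORDER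
EXCLUSION for four down steps at slack four (FINDING-HEX-WALL-SLACK-FOUR-LAW; the four-down law
`12·N = (k − 2)(2k⁴ − 7k³ + 4k² + 7k + 6)`).  OURS (new in writing, modest): the three landing clauses in the equality case
and their slack-four instance; checked against the lane's enumeration of all irreducible positive wall bridges at slack four
with four down steps for `k ≤ 8` (`2463` walks at `k = 8`; no failure of any clause; `2 ∈ E` always).  The printed sources
carry the renewal / irreducible-bridge structure (Madras–Slade §4.2, Definition 4.2.1, remark before (4.2.21), p. 94), the
brickwork frame of the honeycomb lattice (Enting–Jensen §7.4.2, Fig. 7.10) and the surface-visit statistic (Beaton et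
al. §3.1) — none states these facts.  No `set_option maxHeartbeats` line is used.
-/

namespace Literature.Probability.RandomPlanarGeometry.SAW.HexBW.Wall

open Finset Filter Function
open Literature.Probability.LatticeModels Literature.Probability.Percolation SimpleGraph

variable {n : ℕ} {ω : ℕ → Site 2}

/-- [folklore] Two coordinates determine a site of `ℤ²`. -/
private theorem site_ext_ll {p q : Site 2} (h0 : p 0 = q 0) (h1 : p 1 = q 1) : p = q := by
  funext k
  fin_cases k
  · exact h0
  · exact h1

/-! ### §1 The landing law in the equality case of the sharp down-step count -/

open Classical in
/-- **Landing law.** Let `ω ∈ ipwb n` be an irreducible positive wall bridge for which the sharp down-step count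
is an EQUALITY, `n + 4 + 2·#E ≤ X_n + 2·#down + 4v` (`E` = the interior visit times that are near-renewals).  Then:
(i) every left step landing on an EVEN column lands on the column of an interior visit time `t < n`; (ii) every left step
landing on an ODD column `c` has an interior visit time `t < n` with `X_t = c + 1` that is NOT a near-renewal; (iii) two
left steps landing on the same column are the same step.  NEW, a-idea-1 lineage.
[cite: MadrasSlade1993, §4.2, remark before (4.2.21) (p. 94: an irreducible bridge of span L has at least 3L steps)] -/
theorem landing_law (hω : ω ∈ ipwb n)
    (heq : (n : ℤ) + 4 + 2 * #(((wallTimes n ω).erase n).filter fun t => NearRenewal n ω t) ≤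
      ω n 0 + 2 * #(stepsD n ω) + 4 * (visits n ω : ℤ)) :
    (∀ i, i < n → ω (i + 1) 0 = ω i 0 - 1 → ω (i + 1) 0 % 2 = 0 →
        ∃ t ∈ (wallTimes n ω).erase n, ω t 0 = ω (i + 1) 0) ∧
      (∀ i, i < n → ω (i + 1) 0 = ω i 0 - 1 → ω (i + 1) 0 % 2 ≠ 0 →
        ∃ t ∈ (wallTimes n ω).erase n, ¬ NearRenewal n ω t ∧ ω t 0 = ω (i + 1) 0 + 1) ∧
      (∀ i j, i < n → j < n → ω (i + 1) 0 = ω i 0 - 1 → ω (j + 1) 0 = ω j 0 - 1 →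
        ω (i + 1) 0 = ω (j + 1) 0 → i = j) := by
  classical
  obtain ⟨hp, hn1, hirr⟩ := mem_ipwb.1 hω
  obtain ⟨hw, hb⟩ := mem_pwb.1 hp
  obtain ⟨ha, -⟩ := mem_wbr.1 hw
  obtain ⟨hh, hn2, hYn⟩ := mem_archs.1 ha
  obtain ⟨hs, hhp⟩ := mem_hpw.1 hh
  obtain ⟨h0, hend, hbw, hinj⟩ := mem_saws_iff.1 hs
  have hX0 : ω 0 0 = 0 := by rw [h0]; rfl
  have hY0 : ω 0 1 = 0 := by rw [h0]; rfl
  obtain ⟨hcnt, hX, hY⟩ := steps_count hbw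
  rw [hX0, sub_zero] at hX
  rw [hY0, hYn, sub_zero] at hY
  set R := stepsR n ω
  set L := stepsL n ω
  set U := stepsU n ω
  set D := stepsD n ω
  set W := wallTimes n ω with hWdef
  have hmemW : ∀ {t}, t ∈ W ↔ (1 ≤ t ∧ t ≤ n) ∧ t % 2 = 0 ∧ ω t 1 = 0 := fun {t} => by
    rw [hWdef, wallTimes, Finset.mem_filter, Finset.mem_Icc]
  have hWinj : ∀ {t t'}, t ∈ W → t' ∈ W → ω t 0 = ω t' 0 → t = t' := fun {t t'} ht ht' he => by
    obtain ⟨⟨-, htn⟩, -, hy⟩ := hmemW.1 ht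
    obtain ⟨⟨-, htn'⟩, -, hy'⟩ := hmemW.1 ht'
    exact hinj (show t ∈ {i | i ≤ n} from htn) (show t' ∈ {i | i ≤ n} from htn') (site_ext_ll he (by rw [hy, hy']))
  have hWeven : ∀ {t}, t ∈ W → ω t 0 % 2 = 0 := fun {t} ht => by
    obtain ⟨⟨ht1, htn⟩, ht2, hy⟩ := hmemW.1 ht
    have hpar := parity_apply hs htn
    rw [hy, add_zero] at hpar
    omega
  -- interior visit times
  have hnW : n ∈ W := hmemW.2 ⟨⟨hn1, le_rfl⟩, hn2, hYn⟩
  set W' := W.erase n with hW'def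
  have hWW' : #W = #W' + 1 := (Finset.card_erase_add_one hnW).symm
  have hmemW' : ∀ {t}, t ∈ W' → 1 ≤ t ∧ t < n ∧ t % 2 = 0 ∧ ω t 1 = 0 ∧ t ∈ W := fun {t} ht => by
    obtain ⟨hne, htW⟩ := Finset.mem_erase.1 ht
    obtain ⟨⟨ht1, htn⟩, ht2, hy⟩ := hmemW.1 htW
    exact ⟨ht1, lt_of_le_of_ne htn hne, ht2, hy, htW⟩
  set E := W'.filter fun t => NearRenewal n ω t with hEdef
  have hEW' : E ⊆ W' := Finset.filter_subset _ _
  have hsd : #(W' \ E) + #E = #W' := Finset.card_sdiff_add_card_eq_card hEW'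
  set Lod := L.filter fun i => ¬ ω (i + 1) 0 % 2 = 0 with hLod
  set Lev := L.filter fun i => ω (i + 1) 0 % 2 = 0 with hLev
  have hLsplit : #Lev + #Lod = #L := Finset.card_filter_add_card_filter_not _
  have hmemL : ∀ {i}, i ∈ L ↔ i < n ∧ ω (i + 1) 0 = ω i 0 - 1 := fun {i} => by
    show i ∈ stepsL n ω ↔ _; rw [stepsL, Finset.mem_filter, Finset.mem_range]
  -- (a) the map `φ`: an interior visit time `t ↦` the left step landing on the (even) column `X_t`
  have hexφ : ∀ t ∈ W', ∃ i, i < n ∧ ω (i + 1) 0 = ω i 0 - 1 ∧ ω (i + 1) 0 = ω t 0 := fun t ht => by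
    obtain ⟨ht1, htn, ht2, hy, -⟩ := hmemW' ht
    obtain ⟨⟨h1 | h1, -⟩, ⟨h0', -⟩, hne⟩ := wall_steps_horizontal hp ht1 htn ht2 hy
    · exact exists_left_step_onto hω ht1 htn ht2 hy h1
    · refine ⟨t - 1, by omega, ?_, ?_⟩
      · rw [show t - 1 + 1 = t by omega]; omega
      · rw [show t - 1 + 1 = t by omega]
  let φ : ℕ → ℕ := fun t => if h : t ∈ W' then Classical.choose (hexφ t h) else 0
  have hφ : ∀ t (h : t ∈ W'), φ t < n ∧ ω (φ t + 1) 0 = ω (φ t) 0 - 1 ∧ ω (φ t + 1) 0 = ω t 0 := fun t h => by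
    simp only [φ, dif_pos h]; exact Classical.choose_spec (hexφ t h)
  have hφm : Set.MapsTo φ (W' : Set ℕ) (Lev : Set ℕ) := fun t ht => by
    have ht' := Finset.mem_coe.1 ht
    obtain ⟨h1, h2, h3⟩ := hφ t ht'
    have htW := (hmemW' ht').2.2.2.2
    rw [Finset.mem_coe, hLev, Finset.mem_filter, hmemL]
    exact ⟨⟨h1, h2⟩, by rw [h3]; exact hWeven htW⟩
  have hφi : Set.InjOn φ (W' : Set ℕ) := fun t ht t' ht' he => by
    have h1 := Finset.mem_coe.1 ht
    have h2 := Finset.mem_coe.1 ht'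
    obtain ⟨-, -, e1⟩ := hφ t h1
    obtain ⟨-, -, e2⟩ := hφ t' h2
    exact hWinj (hmemW' h1).2.2.2.2 (hmemW' h2).2.2.2.2 (by rw [← e1, ← e2, he])
  have hBev : #W' ≤ #Lev := Finset.card_le_card_of_injOn φ hφm hφi
  -- (b) the map `ψ`: an interior visit time that is not a near-renewal `t ↦` the left step landing on `X_t − 1`
  have hexψ : ∀ t ∈ W' \ E, ∃ i, i < n ∧ ω (i + 1) 0 = ω i 0 - 1 ∧ ω (i + 1) 0 = ω t 0 - 1 := fun t ht => by
    rw [Finset.mem_sdiff] at ht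
    obtain ⟨ht', htE⟩ := ht
    obtain ⟨ht1, htn, ht2, hy, -⟩ := hmemW' ht'
    rcases exists_left_step_onto_pred hω ht1 htn ht2 hy with h | h
    · exact h
    · exact absurd (show t ∈ E by rw [hEdef, Finset.mem_filter]; exact ⟨ht', h⟩) htE
  let ψ : ℕ → ℕ := fun t => if h : t ∈ W' \ E then Classical.choose (hexψ t h) else 0
  have hψ : ∀ t (h : t ∈ W' \ E), ψ t < n ∧ ω (ψ t + 1) 0 = ω (ψ t) 0 - 1 ∧ ω (ψ t + 1) 0 = ω t 0 - 1 :=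
    fun t h => by simp only [ψ, dif_pos h]; exact Classical.choose_spec (hexψ t h)
  have hW'of : ∀ {t}, t ∈ W' \ E → t ∈ W := fun {t} ht => (hmemW' (Finset.mem_sdiff.1 ht).1).2.2.2.2
  have hψm : Set.MapsTo ψ ((W' \ E : Finset ℕ) : Set ℕ) (Lod : Set ℕ) := fun t ht => by
    have ht' := Finset.mem_coe.1 ht
    obtain ⟨h1, h2, h3⟩ := hψ t ht'
    have hev := hWeven (hW'of ht')
    rw [Finset.mem_coe, hLod, Finset.mem_filter, hmemL]
    exact ⟨⟨h1, h2⟩, by rw [h3]; omega⟩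
  have hψi : Set.InjOn ψ ((W' \ E : Finset ℕ) : Set ℕ) := fun t ht t' ht' he => by
    have h1 := Finset.mem_coe.1 ht
    have h2 := Finset.mem_coe.1 ht'
    obtain ⟨-, -, e1⟩ := hψ t h1
    obtain ⟨-, -, e2⟩ := hψ t' h2
    exact hWinj (hW'of h1) (hW'of h2) (by
      have : ω t 0 - 1 = ω t' 0 - 1 := by rw [← e1, ← e2, he]
      omega)
  have hBod : #(W' \ E) ≤ #Lod := Finset.card_le_card_of_injOn ψ hψm hψi
  -- (c) the equality case: both maps are onto
  have hvW : visits n ω = #W := visits_eq_card n ω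
  have hcnt' : ((#R + #L + #U + #D : ℕ) : ℤ) = n := by exact_mod_cast hcnt
  push_cast at hcnt'
  rw [hvW, hWW'] at heq
  push_cast at heq
  have hLevW : #Lev = #W' := by omega
  have hLodW : #Lod = #(W' \ E) := by omega
  have hφs : Set.SurjOn φ (W' : Set ℕ) (Lev : Set ℕ) := Finset.surjOn_of_injOn_of_card_le φ hφm hφi hLevW.le
  have hψs : Set.SurjOn ψ ((W' \ E : Finset ℕ) : Set ℕ) (Lod : Set ℕ) :=
    Finset.surjOn_of_injOn_of_card_le ψ hψm hψi hLodW.le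
  have hevL : ∀ {i}, i < n → ω (i + 1) 0 = ω i 0 - 1 → ω (i + 1) 0 % 2 = 0 →
      ∃ t, t ∈ W' ∧ φ t = i := fun {i} hi hL hev => by
    have hiL : i ∈ (Lev : Set ℕ) := by
      rw [Finset.mem_coe, hLev, Finset.mem_filter, hmemL]; exact ⟨⟨hi, hL⟩, hev⟩
    obtain ⟨t, ht, hti⟩ := hφs hiL
    exact ⟨t, Finset.mem_coe.1 ht, hti⟩
  have hodL : ∀ {i}, i < n → ω (i + 1) 0 = ω i 0 - 1 → ω (i + 1) 0 % 2 ≠ 0 →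
      ∃ t, t ∈ W' \ E ∧ ψ t = i := fun {i} hi hL hod => by
    have hiL : i ∈ (Lod : Set ℕ) := by
      rw [Finset.mem_coe, hLod, Finset.mem_filter, hmemL]; exact ⟨⟨hi, hL⟩, hod⟩
    obtain ⟨t, ht, hti⟩ := hψs hiL
    exact ⟨t, Finset.mem_coe.1 ht, hti⟩
  refine ⟨fun i hi hL hev => ?_, fun i hi hL hod => ?_, fun i j hi hj hLi hLj he => ?_⟩
  · obtain ⟨t, ht, hti⟩ := hevL hi hL hev
    obtain ⟨-, -, h3⟩ := hφ t ht
    rw [hti] at h3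
    exact ⟨t, ht, h3.symm⟩
  · obtain ⟨t, ht, hti⟩ := hodL hi hL hod
    obtain ⟨-, -, h3⟩ := hψ t ht
    rw [hti] at h3
    obtain ⟨ht', htE⟩ := Finset.mem_sdiff.1 ht
    refine ⟨t, ht', fun hnr => htE ?_, by rw [h3]; ring⟩
    rw [hEdef, Finset.mem_filter]
    exact ⟨ht', hnr⟩
  · by_cases hev : ω (i + 1) 0 % 2 = 0
    · obtain ⟨t, ht, hti⟩ := hevL hi hLi hev
      obtain ⟨t', ht', htj⟩ := hevL hj hLj (by rw [← he]; exact hev)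
      obtain ⟨-, -, e1⟩ := hφ t ht
      obtain ⟨-, -, e2⟩ := hφ t' ht'
      rw [hti] at e1
      rw [htj] at e2
      have htt : t = t' := hWinj (hmemW' ht).2.2.2.2 (hmemW' ht').2.2.2.2 (by rw [← e1, ← e2, he])
      rw [← hti, ← htj, htt]
    · obtain ⟨t, ht, hti⟩ := hodL hi hLi hev
      obtain ⟨t', ht', htj⟩ := hodL hj hLj (by rw [← he]; exact hev)
      obtain ⟨-, -, e1⟩ := hψ t ht
      obtain ⟨-, -, e2⟩ := hψ t' ht'
      rw [hti] at e1
      rw [htj] at e2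
      have htt : t = t' := hWinj (hW'of ht) (hW'of ht') (by
        have : ω t 0 - 1 = ω t' 0 - 1 := by rw [← e1, ← e2, he]
        omega)
      rw [← hti, ← htj, htt]

/-! ### §2 Slack four with four down steps: the equality case, and the near-renewal at time `2` -/

open Classical in
/-- **Landing law at slack four, four down steps.** For an irreducible positive wall bridge of length `6k + 4` (`k ≥ 2`)
with `k` visits and four down steps the sharp down-step count is an equality (`X = 2k + 2, #E = 1` or `X = 2k + 4, #E = 2`
by `slack_four_counts`), so: every left step landing on an even column lands on the column of an interior visit time;
every left step landing on an odd column `c` has an interior visit time with column `c + 1` that is not a near-renewal;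
no two left steps land on the same column.  NEW, a-idea-1 lineage.
[cite: MadrasSlade1993, §4.2, remark before (4.2.21) (p. 94); EntingJensen2009, §7.4.2, Fig. 7.10] -/
theorem landing_law_four_down {k m : ℕ} (hk : 2 ≤ k) (hm : m = 6 * k + 4) (hω : ω ∈ ipwb m) (hv : visits m ω = k)
    (hcD : #(stepsD m ω) = 4) :
    (∀ i, i < m → ω (i + 1) 0 = ω i 0 - 1 → ω (i + 1) 0 % 2 = 0 →
        ∃ t ∈ (wallTimes m ω).erase m, ω t 0 = ω (i + 1) 0) ∧
      (∀ i, i < m → ω (i + 1) 0 = ω i 0 - 1 → ω (i + 1) 0 % 2 ≠ 0 →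
        ∃ t ∈ (wallTimes m ω).erase m, ¬ NearRenewal m ω t ∧ ω t 0 = ω (i + 1) 0 + 1) ∧
      (∀ i j, i < m → j < m → ω (i + 1) 0 = ω i 0 - 1 → ω (j + 1) 0 = ω j 0 - 1 →
        ω (i + 1) 0 = ω (j + 1) 0 → i = j) := by
  classical
  obtain ⟨hX3, -, -, -, -, -, h6, h2, h4⟩ := slack_four_counts hk hm hω hv
  refine landing_law hω ?_
  rw [hcD, hv]
  push_cast
  rcases hX3 with hX | hX | hX
  · have hE := (h2 hX).2.2 hcD
    rw [hE, hX, hm]; push_cast; omega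
  · have hE := ((h4 hX).1 hcD).1
    rw [hE, hX, hm]; push_cast; omega
  · have hD2 := (h6 hX).1
    omega

open Classical in
/-- **The near-renewal at time `2`.** For an irreducible positive wall bridge of length `6k + 4` (`k ≥ 2`) with `k` visits
and four down steps, the time `2` is an interior visit time that is a near-renewal (`#E = #E₄ + 1` by `slack_four_counts`,
and `2` is the only even time in `[1, 4)`); in particular `ω 2 = (2, 0)`, so the first dive of the walk is at a column
`≥ 3`.  NEW, a-idea-1 lineage.
[cite: MadrasSlade1993, §4.2, remark before (4.2.21) (p. 94); EntingJensen2009, §7.4.2, Fig. 7.10] -/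
theorem two_mem_nearRenewal_four_down {k m : ℕ} (hk : 2 ≤ k) (hm : m = 6 * k + 4) (hω : ω ∈ ipwb m)
    (hv : visits m ω = k) (hcD : #(stepsD m ω) = 4) :
    2 ∈ (wallTimes m ω).erase m ∧ NearRenewal m ω 2 ∧ ω 2 0 = 2 ∧ ω 2 1 = 0 := by
  classical
  obtain ⟨hX3, -, -, -, -, -, h6, h2, h4⟩ := slack_four_counts hk hm hω hv
  set E := ((wallTimes m ω).erase m).filter fun t => NearRenewal m ω t with hE
  set E₄ := ((wallTimes m ω).erase m).filter fun t => 4 ≤ t ∧ NearRenewal m ω t with hE₄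
  have hlt : #E₄ < #E := by
    rcases hX3 with hX | hX | hX
    · obtain ⟨h40, -, h41⟩ := h2 hX
      have := h41 hcD
      omega
    · obtain ⟨hE2, hE1⟩ := (h4 hX).1 hcD
      omega
    · have := (h6 hX).1
      omega
  have hex : ∃ t ∈ E, t < 4 := by
    by_contra hne
    have hsub : E ⊆ E₄ := fun t ht => by
      have h4t : 4 ≤ t := not_lt.1 fun h => hne ⟨t, ht, h⟩
      rw [hE, Finset.mem_filter] at ht
      rw [hE₄, Finset.mem_filter]
      exact ⟨ht.1, h4t, ht.2⟩
    exact absurd (Finset.card_le_card hsub) (not_le.2 hlt)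
  obtain ⟨t, ht, ht4⟩ := hex
  rw [hE, Finset.mem_filter, Finset.mem_erase] at ht
  obtain ⟨⟨htm, htW⟩, hnr⟩ := ht
  have htW' := htW
  rw [wallTimes, Finset.mem_filter, Finset.mem_Icc] at htW
  obtain ⟨⟨ht1, -⟩, ht2, hy⟩ := htW
  obtain rfl : t = 2 := by omega
  obtain ⟨hp, -, -⟩ := mem_ipwb.1 hω
  obtain ⟨hw, hb⟩ := mem_pwb.1 hp
  obtain ⟨ha, -⟩ := mem_wbr.1 hw
  obtain ⟨hh, -, -⟩ := mem_archs.1 ha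
  obtain ⟨hs, -⟩ := mem_hpw.1 hh
  obtain ⟨h0, -, hbw, -⟩ := mem_saws_iff.1 hs
  have hX0 : ω 0 0 = 0 := by rw [h0]; rfl
  have hY0 : ω 0 1 = 0 := by rw [h0]; rfl
  have hb1 := (hb 1 (by omega) (by omega)).1
  have hb2 := (hb 2 (by omega) (by omega)).1
  rw [hX0] at hb1 hb2
  have h01 := (brickWallGraph_adj_coord (ω 0) (ω 1)).1 (hbw 0 (by omega))
  have h12 := (brickWallGraph_adj_coord (ω 1) (ω 2)).1 (hbw 1 (by omega))
  refine ⟨Finset.mem_erase.2 ⟨htm, htW'⟩, hnr, ?_, hy⟩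
  rw [hX0, hY0] at h01
  omega

end Literature.Probability.RandomPlanarGeometry.SAW.HexBW.Wall
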